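import Summits.QuantumFields.BalabanUV.Beta.GAN24.MonotoneTorusLandau
import Summits.QuantumFields.BalabanUV.Beta.GAN24.MonotoneTorusHodge
import Summits.QuantumFields.BalabanUV.Beta.GAN24.MonotoneTorusEffective

/-!
# Beta / GAN24 / MonotoneTorusLandauTower — BAŁABAN'S OWN CONSTRAINED FLUCTUATION COVARIANCE IN THE MONOTONE CHAIN: the sub-block plaquette content of
# the tree's gauge-fixed `𝒞 = 𝒫G` ((1.107), `FluctuationProjection.Cov`) at blocking `Lc·Lc^j` over the unit torus IS, up to the explicit unit factor
# `½·Lc^{dj+2}` (= `½Lc^{2−d}` times the `η^{−d}` weight of (1.21)), road P4's `plaqCov (QvOp Lc M₀) j` — hence Loewner-ANTITONE in `j`, no rate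
# (gan24-p4 gen 4; BINDER-OWNERS row G-an2-4 ∕ (CONV-C), ALTERNATIVE DISCHARGE «rate OR monotonicity»; NOT IN PRINT — our proof attempt)

HONEST FRAMING (page 1 of everything the β sub-cell writes): discharging `BetaPertH` makes Bałaban's UV stability UNCONDITIONAL — a
real constructive-QFT result; it is NOT the continuum limit and NOT the Clay problem.  HONEST DEPENDENCY (cell reorg 2026-08-19, verbatim):
«continuum YM on T⁴ ⇐ BetaPertH ∧ nine spine estimates (0/9 proved); BetaPertH ⇐ (D1) ∧ (D4) ∧ CAP+tail; G-an2-4 gates asym, D1 and NE2/3/4.»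
HONEST LABEL: «not in print; our proof attempt; alternative discharge of the G-an2-4 row (rate OR monotonicity)»; 0 wall binders instantiated.
ABSOLUTE RULE honoured: NOTHING is cited here as a fact.  Tree inputs BY NAME: `B5Composition116.{sites, sitesV, QvOp_comp, recast_add, recast_tstep}`
((1.16)–(1.17)), `Beta.FluctuationProjection.Cov`∕`Cov_conjTranspose`, gen 3's `MonotoneTorusTower`∕`MonotoneTorusPlaquette`∕`MonotoneTorusHodge`
(`QvOp_mulVec_gradOp` = (1.20) BY NAME), gen 4's `MonotoneTorusLandau.isCrit_Cov_of_coclosed` and `MonotoneTorusEffective.curlOp_quad_eq`.  [folklore] glue.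

## THE GEOMETRY.  Unit torus `Tor M₀`; `M₁ := fine Lc M₀` (the `Lc⁻¹`-lattice); level `j`: Bałaban's fine lattice `X_j := Tor (fine (Lc·Lc^j) M₀)` (spacing
`η = (Lc^{j+1})⁻¹`) carries `𝒞_j := Cov (Lc·Lc^j) M₀` — the covariance of `exp(−½⟨A,Δ_aA⟩)` conditioned on `Q_{Lc^{j+1}} A = 0` and the printed weak-Landau
gauge `R∂*A = 0`; the road-P4 tower over the READ-OUT torus `M₁` with unit-block rows `R = QvOp Lc M₀` has level-`j` lattice `Y_j := Tor (fine (Lc^j) M₁)`,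
identified with `X_j` by `B5Composition116.sitesV Lc (Lc^j) M₀`; its constraint `rows R j = Q_{Lc} ∘ Q_{Lc^j}` is `Q_{Lc·Lc^j}` transported ((1.17),
`QvOp_comp`).  `T j := (curlMat M₁ * sread j).submatrix id (sitesV …)` reads the PLAQUETTES OF THE `Lc^j`-BLOCK AVERAGES of an `X_j`-field on `M₁`.

## WHAT IS PROVED
* §1 reindexing [folklore]: `sites_add_unitVec'`, `gradOp_mulVec_reindex`, `plaq_reindex`, `curlEnergy_reindex'`, `dotProduct_comp_equiv'`, `isCrit_reindex`,
  `isCrit_smul_form`.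
* §2 `rows_submatrix_eq_QvOp` (`(rows R j).submatrix id e = Q_{Lc·Lc^j}`), `plaq_gradOp_eq_zero`, **`T_mul_gradOp_coclosed`** (the read sources `(T j)ᴴu` are
  CO-CLOSED fine fields — (1.20) + curl∘grad = 0), `curlForm_reindex_eq_smul_hform` (`½∂ᴴ∂` on `X_j` = `c_j • hform j` transported, `c_j = ½(Lc·Lc^j)²/scal j`).
* §3 **`plaqCov_eq_smul_readOut_Cov : plaqCov Lc M₁ (QvOp Lc M₀) j = c_j • (T j · 𝒞_j · (T j)ᴴ)`** and **`readOut_Cov_antitone_step`**: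
  `c_{j+1} • T (j+1)·𝒞_{j+1}·T (j+1)ᴴ ≤ c_j • T j·𝒞_j·(T j)ᴴ` — Bałaban's OWN gauge-fixed constrained fluctuation covariances, read through his OWN sub-block
  averages' plaquettes, DECREASE with the step in the Loewner order (the unit factor `c_j = ½Lc²·Lc^{dj}` is `½Lc^{2−d}` times the `(1.21)` weight `η^{−d} = (Lc^{j+1})^d`).
WHAT THIS IS NOT: no rate; nothing on gauge-variant blocks; torus, `U = 1`; NOT (CONV-C), NOT BetaPertH, NOT continuum, NOT Clay.
-/

noncomputable section

namespace Summit.QuantumFields.BalabanUV.Beta.GAN24.MonotoneTorusLandauTower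

open Matrix Finset
open scoped BigOperators ComplexOrder
open Literature.MathematicalPhysics.QuantumFieldTheory.Balaban1983to89
open Literature.MathematicalPhysics.QuantumFieldTheory.Balaban1983to89.B5Prop11Plancherel (Tor fine unitVec)
open Literature.MathematicalPhysics.QuantumFieldTheory.Balaban1983to89.B5Block118 (QvOp QsOp)
open Literature.MathematicalPhysics.QuantumFieldTheory.Balaban1983to89.B5Action121 (GradOp GradOp_mulVec sdiff_mulVec CurlOp)
open Literature.MathematicalPhysics.QuantumFieldTheory.Balaban1983to89.B5AverageCurlStokes (plaq plaq_apply)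
open Literature.MathematicalPhysics.QuantumFieldTheory.Balaban1983to89.B5Composition116 (recast_add recast_tstep sites sitesV sitesV_symm_apply QvOp_comp)
open Literature.MathematicalPhysics.QuantumFieldTheory.Balaban1983to89.Beta.FluctuationProjection (Cov Cov_conjTranspose)
open Summit.QuantumFields.BalabanUV.Beta.GAN24.MonotoneCoarsen (IsCrit conj_pairing)
open Summit.QuantumFields.BalabanUV.Beta.GAN24.MonotoneShorted (readOut_quad hermitian_ext_of_quad mem_ker_iff)
open Summit.QuantumFields.BalabanUV.Beta.GAN24.MonotoneTorusTower (Lev sread rows hform hform_isHermitian hform_quad scal curlMat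
  curlMat_mulVec curlEnergy quad_curlMat unitVec_eq_tstep)
open Summit.QuantumFields.BalabanUV.Beta.GAN24.MonotoneTorusPlaquette (scal_pos plaqCov plaqCov_quad_eq_of_isCrit plaqCov_posSemidef
  plaqCov_antitone_step)
open Summit.QuantumFields.BalabanUV.Beta.GAN24.MonotoneTorusHodge (QvOp_mulVec_gradOp)
open Summit.QuantumFields.BalabanUV.Beta.GAN24.MonotoneTorusEffective (curlOp_quad_eq)
open Summit.QuantumFields.BalabanUV.Beta.GAN24.MonotoneTorusLandau (curlForm curlForm_isHermitian curlForm_posSemidef isCrit_Cov_of_coclosed)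

variable {d : ℕ}

/-! ## §1 Reindexing along an index equivalence -/

section Reindex

omit d in
/-- `⟨w, f ∘ e⁻¹⟩ = ⟨w ∘ e, f⟩`. [folklore] -/
theorem dotProduct_comp_equiv' {X Y : Type*} [Fintype X] [Fintype Y] (e : X ≃ Y) (w : Y → ℂ) (f : X → ℂ) :
    star w ⬝ᵥ (f ∘ e.symm) = star (w ∘ e) ⬝ᵥ f := by
  simp only [dotProduct, Pi.star_apply, Function.comp_apply]
  exact (Fintype.sum_equiv e.symm _ _ fun y => by simp)

omit d in
/-- **CRITICALITY IS INVARIANT UNDER REINDEXING**: a critical point on `X` transports along `e : X ≃ Y` to a critical point for the transported form,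
source and constraint rows. [folklore] -/
theorem isCrit_reindex {X Y ρ : Type*} [Fintype X] [Fintype Y] [Fintype ρ] (e : X ≃ Y) {H : Matrix X X ℂ} {r v : X → ℂ} {Q : Matrix ρ X ℂ}
    (h : IsCrit H r (LinearMap.ker Q.mulVecLin) v) :
    IsCrit (H.submatrix e.symm e.symm) (r ∘ e.symm) (LinearMap.ker (Q.submatrix id e.symm).mulVecLin) (v ∘ e.symm) := by
  refine ⟨(mem_ker_iff _ _).mpr ?_, fun w hw => ?_⟩
  · rw [submatrix_mulVec_equiv, Equiv.symm_symm]
    simp only [Function.comp_assoc, Equiv.symm_comp_self, Function.comp_id]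
    exact (mem_ker_iff Q v).mp h.1
  · have hw' : Q *ᵥ (w ∘ e) = 0 := by
      have h0 := (mem_ker_iff _ w).mp hw
      rw [submatrix_mulVec_equiv, Equiv.symm_symm] at h0
      simpa only [Function.comp_id] using h0
    have h1 := h.2 (w ∘ e) ((mem_ker_iff Q _).mpr hw')
    have e1 : (H.submatrix e.symm e.symm) *ᵥ (v ∘ e.symm) = (H *ᵥ v) ∘ e.symm := by
      rw [submatrix_mulVec_equiv, Equiv.symm_symm]
      simp only [Function.comp_assoc, Equiv.symm_comp_self, Function.comp_id]
    rw [e1, show (r ∘ e.symm) - (H *ᵥ v) ∘ e.symm = (r - H *ᵥ v) ∘ e.symm from rfl, dotProduct_comp_equiv', h1]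

omit d in
/-- Scaling the form scales the critical point inversely: `IsCrit (c • H) r K v ⟹ IsCrit H r K (c • v)`. [folklore] -/
theorem isCrit_smul_form {X : Type*} [Fintype X] {H : Matrix X X ℂ} {r v : X → ℂ} {K : Submodule ℂ (X → ℂ)} (c : ℂ)
    (h : IsCrit (c • H) r K v) : IsCrit H r K (c • v) :=
  ⟨K.smul_mem c h.1, fun w hw => by rw [mulVec_smul, ← smul_mulVec]; exact h.2 w hw⟩

end Reindex

/-! ## §2 The geometry: sub-block readings of Bałaban's fine field, their co-closedness, the curl form in the tower's units -/

section Geometry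

variable (Lc : ℕ) [NeZero Lc] (M₀ : Fin d → ℕ) [hM : ∀ μ, NeZero (M₀ μ)]

/-- The site identification `X_j = Tor (fine (Lc·Lc^j) M₀) ≃ Tor (fine (Lc^j) (fine Lc M₀)) = Y_j` on 1-forms (`B5Composition116.sitesV`). [folklore] -/
abbrev eqv (j : ℕ) : Tor (fine (Lc * Lc ^ j) M₀) × Fin d ≃ Lev Lc (fine Lc M₀) j := sitesV Lc (Lc ^ j) M₀

omit [NeZero Lc] hM in
/-- `sites (x + e_μ) = sites x + e_μ`. [folklore] -/
theorem sites_add_unitVec' (j : ℕ) (x : Tor (fine (Lc * Lc ^ j) M₀)) (μ : Fin d) :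
    sites Lc (Lc ^ j) M₀ (x + unitVec _ μ) = sites Lc (Lc ^ j) M₀ x + unitVec _ μ := by
  unfold sites
  rw [recast_add, unitVec_eq_tstep, unitVec_eq_tstep, recast_tstep]

omit [NeZero Lc] hM in
/-- `sites⁻¹ (y + e_μ) = sites⁻¹ y + e_μ`. [folklore] -/
theorem sites_symm_add_unitVec (j : ℕ) (y : Tor (fine (Lc ^ j) (fine Lc M₀))) (μ : Fin d) :
    (sites Lc (Lc ^ j) M₀).symm (y + unitVec _ μ) = (sites Lc (Lc ^ j) M₀).symm y + unitVec _ μ := by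
  rw [Equiv.symm_apply_eq, sites_add_unitVec', Equiv.apply_symm_apply]

/-- **THE GRADIENT COMMUTES WITH THE REINDEXING**: `(∂_X λ) ∘ e⁻¹ = ∂_Y (λ ∘ sites⁻¹)`. [folklore] -/
theorem gradOp_mulVec_reindex (j : ℕ) (lam : Tor (fine (Lc * Lc ^ j) M₀) → ℂ) :
    (GradOp (fine (Lc * Lc ^ j) M₀) 1 *ᵥ lam) ∘ (eqv Lc M₀ j).symm
      = GradOp (fine (Lc ^ j) (fine Lc M₀)) 1 *ᵥ (lam ∘ (sites Lc (Lc ^ j) M₀).symm) := by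
  funext b
  obtain ⟨y, μ⟩ := b
  rw [Function.comp_apply, sitesV_symm_apply, GradOp_mulVec, sdiff_mulVec, GradOp_mulVec, sdiff_mulVec, Function.comp_apply, Function.comp_apply,
    sites_symm_add_unitVec]

omit [NeZero Lc] hM in
/-- Plaquettes commute with the reindexing: `plaq_Y (v ∘ e⁻¹) μ ν (sites x) = plaq_X v μ ν x`. [folklore] -/
theorem plaq_reindex (j : ℕ) (v : Tor (fine (Lc * Lc ^ j) M₀) × Fin d → ℂ) (μ ν : Fin d) (x : Tor (fine (Lc * Lc ^ j) M₀)) :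
    plaq (fine (Lc ^ j) (fine Lc M₀)) (v ∘ (eqv Lc M₀ j).symm) μ ν (sites Lc (Lc ^ j) M₀ x) = plaq (fine (Lc * Lc ^ j) M₀) v μ ν x := by
  simp only [plaq_apply, Function.comp_apply, ← sites_add_unitVec', sitesV_symm_apply, Equiv.symm_apply_apply]

/-- The curl energy is invariant under the reindexing. [folklore] -/
theorem curlEnergy_reindex' (j : ℕ) (v : Tor (fine (Lc * Lc ^ j) M₀) × Fin d → ℂ) :
    curlEnergy (fine (Lc ^ j) (fine Lc M₀)) (v ∘ (eqv Lc M₀ j).symm) = curlEnergy (fine (Lc * Lc ^ j) M₀) v := by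
  unfold curlEnergy
  refine Finset.sum_congr rfl fun μ _ => Finset.sum_congr rfl fun ν _ => ?_
  rw [← Equiv.sum_comp (sites Lc (Lc ^ j) M₀)]
  exact Finset.sum_congr rfl fun x _ => by rw [plaq_reindex]

/-- **THE READING**: `T j := (curlMat M₁ * sread j).submatrix id e` — the plaquettes on `M₁ = fine Lc M₀` of the `Lc^j`-block averages (1.18) of a field on
Bałaban's fine lattice `X_j`. [folklore] -/
def T (j : ℕ) : Matrix (Fin d × Fin d × Tor (fine Lc M₀)) (Tor (fine (Lc * Lc ^ j) M₀) × Fin d) ℂ :=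
  (curlMat (fine Lc M₀) * sread Lc (fine Lc M₀) j).submatrix id (eqv Lc M₀ j)

/-- **(1.17) TRANSPORTED**: the tower's unit-block constraint rows at level `j`, reindexed to `X_j`, ARE Bałaban's `Q_{Lc·Lc^j}`:
`(rows (QvOp Lc M₀) j).submatrix id e = QvOp (Lc·Lc^j) M₀` (`B5Composition116.QvOp_comp` BY NAME). [folklore] -/
theorem rows_submatrix_eq_QvOp (j : ℕ) :
    (rows Lc (fine Lc M₀) (QvOp Lc M₀) j).submatrix id (eqv Lc M₀ j) = QvOp (Lc * Lc ^ j) M₀ := by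
  rw [rows, sread, ← QvOp_comp Lc (Lc ^ j) M₀]
  rw [show (QvOp Lc M₀ * QvOp (Lc ^ j) (fine Lc M₀)).submatrix id ⇑(eqv Lc M₀ j)
      = (QvOp Lc M₀).submatrix id id * (QvOp (Lc ^ j) (fine Lc M₀)).submatrix id ⇑(eqv Lc M₀ j) from
    submatrix_mul _ _ _ _ _ Function.bijective_id, submatrix_id_id]

/-- The converse reading: `rows (QvOp Lc M₀) j = (QvOp (Lc·Lc^j) M₀).submatrix id e⁻¹`. [folklore] -/
theorem rows_eq_QvOp_submatrix (j : ℕ) :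
    rows Lc (fine Lc M₀) (QvOp Lc M₀) j = (QvOp (Lc * Lc ^ j) M₀).submatrix id (eqv Lc M₀ j).symm := by
  rw [← rows_submatrix_eq_QvOp, submatrix_submatrix, Function.comp_id, Equiv.self_comp_symm, submatrix_id_id]

omit [NeZero Lc] hM in
/-- The plaquette of a gradient vanishes (`curl ∘ grad = 0` on every torus). [folklore] -/
theorem plaq_gradOp_eq_zero (N : Fin d → ℕ) [∀ μ, NeZero (N μ)] (lam : Tor N → ℂ) (μ ν : Fin d) (x : Tor N) :
    plaq N (GradOp N 1 *ᵥ lam) μ ν x = 0 := by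
  rw [plaq_apply, GradOp_mulVec, sdiff_mulVec, GradOp_mulVec, sdiff_mulVec, GradOp_mulVec, sdiff_mulVec, GradOp_mulVec, sdiff_mulVec,
    add_right_comm x (unitVec N ν) (unitVec N μ)]
  ring

/-- `curlMat N (∂λ) = 0`. [folklore] -/
theorem curlMat_mulVec_gradOp (N : Fin d → ℕ) [∀ μ, NeZero (N μ)] (lam : Tor N → ℂ) : curlMat N *ᵥ (GradOp N 1 *ᵥ lam) = 0 := by
  funext r; obtain ⟨μ, ν, x⟩ := r
  rw [curlMat_mulVec, Pi.zero_apply]; exact plaq_gradOp_eq_zero N lam μ ν x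

omit [NeZero Lc] hM in
/-- `∂^c λ = c • ∂¹ λ` (B5's `GradOp N c` carries the lattice factor `c`). [folklore] -/
theorem gradOp_mulVec_eq_smul (N : Fin d → ℕ) [∀ μ, NeZero (N μ)] (c : ℂ) (lam : Tor N → ℂ) :
    GradOp N c *ᵥ lam = c • (GradOp N 1 *ᵥ lam) := by
  funext b; obtain ⟨x, ν⟩ := b
  rw [Pi.smul_apply, GradOp_mulVec, sdiff_mulVec, GradOp_mulVec, sdiff_mulVec, one_mul, smul_eq_mul]

/-- **THE READINGS KILL GRADIENTS**: `T j (∂_X λ) = 0` — block averages of a gradient are a gradient ((1.20), `QvOp_mulVec_gradOp` BY NAME) and plaquettes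
of a gradient vanish. [folklore] -/
theorem T_mulVec_gradOp (j : ℕ) (c : ℂ) (lam : Tor (fine (Lc * Lc ^ j) M₀) → ℂ) :
    T Lc M₀ j *ᵥ (GradOp (fine (Lc * Lc ^ j) M₀) c *ᵥ lam) = 0 := by
  rw [gradOp_mulVec_eq_smul, mulVec_smul, T, submatrix_mulVec_equiv, Function.comp_id, gradOp_mulVec_reindex, ← mulVec_mulVec, sread,
    QvOp_mulVec_gradOp, curlMat_mulVec_gradOp, smul_zero]

/-- **THE READ SOURCES ARE CO-CLOSED**: `(∂_X)ᴴ ((T j)ᴴ u) = 0` for every plaquette test vector `u` (any lattice factor `c`). [folklore] -/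
theorem T_source_coclosed (j : ℕ) (c : ℂ) (u : Fin d × Fin d × Tor (fine Lc M₀) → ℂ) :
    (GradOp (fine (Lc * Lc ^ j) M₀) c)ᴴ *ᵥ ((T Lc M₀ j)ᴴ *ᵥ u) = 0 := by
  refine MonotoneShorted.eq_zero_of_forall_pairing fun lam => ?_
  have h : star lam ⬝ᵥ ((GradOp (fine (Lc * Lc ^ j) M₀) c)ᴴ *ᵥ ((T Lc M₀ j)ᴴ *ᵥ u))
      = star (T Lc M₀ j *ᵥ (GradOp (fine (Lc * Lc ^ j) M₀) c *ᵥ lam)) ⬝ᵥ u := by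
    rw [← conj_pairing, ← conj_pairing, mulVec_mulVec]
  rw [h, T_mulVec_gradOp, star_zero, zero_dotProduct]

omit [NeZero Lc] hM in
/-- `((A.submatrix id e)ᴴ u) = (Aᴴ u) ∘ e`: the read source of a reindexed reading is the reindexed read source. [folklore] -/
theorem submatrix_conjTranspose_mulVec {p X Y : Type*} [Fintype p] (A : Matrix p Y ℂ) (e : X ≃ Y) (u : p → ℂ) :
    (A.submatrix id e)ᴴ *ᵥ u = (Aᴴ *ᵥ u) ∘ e := by
  funext x
  simp [mulVec, dotProduct, conjTranspose_apply, Matrix.submatrix_apply]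

/-- The unit ratio `c_j := ½·(Lc·Lc^j)²/scal j` between Bałaban's `½∂ᴴ∂` on `X_j` and the tower's `hform j`. [folklore] -/
def cbridge (j : ℕ) : ℝ := 1 / 2 * (((Lc * Lc ^ j : ℕ) : ℝ)) ^ 2 / scal (d := d) Lc j

omit hM in
/-- `c_j > 0`. [folklore] -/
theorem cbridge_pos (j : ℕ) : 0 < cbridge (d := d) Lc j := by
  have hL : 0 < Lc := Nat.pos_of_ne_zero (NeZero.ne Lc)
  have h1 : (0 : ℝ) < ((Lc * Lc ^ j : ℕ) : ℝ) := by positivity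
  unfold cbridge
  exact div_pos (by positivity) (scal_pos Lc hL j)

/-- **BAŁABAN'S CURL FORM IN THE TOWER'S UNITS**: `(½∂ᴴ∂ on X_j)` transported to `Y_j` is `c_j • hform j` (`curlOp_quad_eq`, `curlEnergy_reindex'`, polarisation). [folklore] -/
theorem curlForm_reindex_eq_smul_hform (j : ℕ) :
    (curlForm (Lc * Lc ^ j) M₀).submatrix (eqv Lc M₀ j).symm (eqv Lc M₀ j).symm = ((cbridge (d := d) Lc j : ℝ) : ℂ) • hform Lc (fine Lc M₀) j := by
  have hL : 0 < Lc := Nat.pos_of_ne_zero (NeZero.ne Lc)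
  have hs : scal (d := d) Lc j ≠ 0 := (scal_pos Lc hL j).ne'
  refine B5Action121.ext_of_form_eq fun w => ?_
  have h2 : curlEnergy (fine (Lc * Lc ^ j) M₀) (w ∘ ⇑(eqv Lc M₀ j)) = curlEnergy (fine (Lc ^ j) (fine Lc M₀)) w := by
    rw [← curlEnergy_reindex' Lc M₀ j (w ∘ ⇑(eqv Lc M₀ j)), Function.comp_assoc, Equiv.self_comp_symm, Function.comp_id]
  rw [submatrix_mulVec_equiv, Equiv.symm_symm, dotProduct_comp_equiv']
  simp only [smul_mulVec, dotProduct_smul, smul_eq_mul]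
  rw [hform_quad, ← mulVec_mulVec, ← conj_pairing, curlOp_quad_eq, h2, cbridge]
  push_cast
  field_simp

end Geometry

/-! ## §3 The bridge: Bałaban's `𝒞` read through the sub-block plaquettes IS `plaqCov`, hence antitone -/

section Bridge

variable (Lc : ℕ) [NeZero Lc] (M₀ : Fin d → ℕ) [hM : ∀ μ, NeZero (M₀ μ)]

omit hM in
/-- `1 ≤ Lc·Lc^j`. [folklore] -/
theorem one_le_Lc_mul_pow (j : ℕ) : 1 ≤ Lc * Lc ^ j :=
  Nat.one_le_iff_ne_zero.mpr (mul_ne_zero (NeZero.ne Lc) (pow_ne_zero j (NeZero.ne Lc)))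

/-- **THE BRIDGE**: `plaqCov Lc M₁ (QvOp Lc M₀) j = c_j • (T j · Cov (Lc·Lc^j) M₀ · (T j)ᴴ)` — road P4's level-`j` plaquette covariance over the read-out torus
`M₁ = fine Lc M₀` with unit-block rows IS (up to the unit factor `c_j`) Bałaban's OWN gauge-fixed constrained covariance `𝒞 = 𝒫G` at blocking `Lc·Lc^j`,
read through the plaquettes of his `Lc^j`-block averages.  Mechanism: the read sources are co-closed (`T_source_coclosed`), so by gen 4's
`MonotoneTorusLandau.isCrit_Cov_of_coclosed` the `𝒞`-columns are critical for `½∂ᴴ∂` on `ker Q_{Lc·Lc^j}`; transported along `sitesV` and rescaled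
(`curlForm_reindex_eq_smul_hform`, `rows_eq_QvOp_submatrix`) they are critical for `hform j` on `ker (rows R j)`, and gen 3's slice independence
`plaqCov_quad_eq_of_isCrit` identifies the plaquette pairings. [folklore] -/
theorem plaqCov_eq_smul_readOut_Cov (j : ℕ) (a : ℝ) (ha : 0 < a) :
    plaqCov Lc (fine Lc M₀) (QvOp Lc M₀) j
      = ((cbridge (d := d) Lc j : ℝ) : ℂ) • (T Lc M₀ j * Cov (Lc * Lc ^ j) (one_le_Lc_mul_pow Lc j) M₀ a ha * (T Lc M₀ j)ᴴ) := by
  have h1 : (plaqCov Lc (fine Lc M₀) (QvOp Lc M₀) j).IsHermitian := (plaqCov_posSemidef Lc (fine Lc M₀) (QvOp Lc M₀) j).isHermitian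
  have h2 : ((((cbridge (d := d) Lc j : ℝ) : ℂ)) • (T Lc M₀ j * Cov (Lc * Lc ^ j) (one_le_Lc_mul_pow Lc j) M₀ a ha * (T Lc M₀ j)ᴴ)).IsHermitian :=
    (Matrix.isHermitian_mul_mul_conjTranspose _ (Cov_conjTranspose _ _ _ _ _)).smul (by rw [IsSelfAdjoint, Complex.star_def, Complex.conj_ofReal])
  refine hermitian_ext_of_quad h1 h2 fun u => ?_
  -- the tower-side source `rY` and Bałaban's source `rX = rY ∘ e`
  have hrX : (T Lc M₀ j)ᴴ *ᵥ u = ((curlMat (fine Lc M₀) * sread Lc (fine Lc M₀) j)ᴴ *ᵥ u) ∘ ⇑(eqv Lc M₀ j) :=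
    submatrix_conjTranspose_mulVec _ _ u
  -- the `𝒞`-column at `rX` is critical on `ker Q_{Lc·Lc^j}` for `½∂ᴴ∂` (gen 4 `MonotoneTorusLandau`, the source being co-closed)
  have hcritX := isCrit_Cov_of_coclosed (Lc * Lc ^ j) (one_le_Lc_mul_pow Lc j) M₀ a ha ((T Lc M₀ j)ᴴ *ᵥ u) (T_source_coclosed Lc M₀ j _ u)
  -- transport to the tower's level-`j` lattice and rescale: critical for `hform j` on `ker (rows R j)` at the tower's plaquette source
  have hcritY := isCrit_reindex (eqv Lc M₀ j) hcritX
  rw [curlForm_reindex_eq_smul_hform, ← rows_eq_QvOp_submatrix, hrX, Function.comp_assoc, Equiv.self_comp_symm, Function.comp_id] at hcritY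
  have hcrit := isCrit_smul_form _ hcritY
  -- slice independence on the tower side computes the plaquette pairing
  have hq := plaqCov_quad_eq_of_isCrit Lc (fine Lc M₀) (QvOp Lc M₀) j u hcrit
  rw [← hq, dotProduct_smul, dotProduct_comp_equiv' (eqv Lc M₀ j), ← hrX, smul_mulVec, dotProduct_smul, readOut_quad]

/-- **BAŁABAN'S CONSTRAINED FLUCTUATION COVARIANCES, READ THROUGH HIS SUB-BLOCK PLAQUETTES, DECREASE WITH THE STEP**:
`c_{j+1} • T (j+1)·𝒞_{j+1}·T (j+1)ᴴ ≤ c_j • T j·𝒞_j·(T j)ᴴ` in the Loewner order, every `j`, every unit torus, every `Lc ≥ 1` (gen 3's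
`plaqCov_antitone_step` through the bridge); `c_j = ½Lc²·Lc^{dj}` = `½Lc^{2−d}` × the (1.21) weight `(Lc^{j+1})^d`; NO rate. [folklore] -/
theorem readOut_Cov_antitone_step (j : ℕ) (a : ℝ) (ha : 0 < a) :
    (((cbridge (d := d) Lc j : ℝ) : ℂ) • (T Lc M₀ j * Cov (Lc * Lc ^ j) (one_le_Lc_mul_pow Lc j) M₀ a ha * (T Lc M₀ j)ᴴ)
      - ((cbridge (d := d) Lc (j + 1) : ℝ) : ℂ)
        • (T Lc M₀ (j + 1) * Cov (Lc * Lc ^ (j + 1)) (one_le_Lc_mul_pow Lc (j + 1)) M₀ a ha * (T Lc M₀ (j + 1))ᴴ)).PosSemidef := by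
  rw [← plaqCov_eq_smul_readOut_Cov, ← plaqCov_eq_smul_readOut_Cov]
  exact plaqCov_antitone_step Lc (fine Lc M₀) (QvOp Lc M₀) j

omit hM in
/-- The unit factor explicitly: `c_j = ½ · Lc² · (Lc^d)^j` (so `c_j = ½Lc^{2−d}·(Lc·Lc^j)^d`, the `(1.21)` weight `η^{−d}` up to a `j`-independent constant). [folklore] -/
theorem cbridge_eq (j : ℕ) : cbridge (d := d) Lc j = 1 / 2 * (Lc : ℝ) ^ 2 * ((Lc : ℝ) ^ d) ^ j := by
  have hL : (Lc : ℝ) ≠ 0 := by exact_mod_cast NeZero.ne Lc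
  unfold cbridge scal
  rw [div_pow, ← pow_mul, ← pow_mul]
  push_cast
  field_simp
  ring

end Bridge

end Summit.QuantumFields.BalabanUV.Beta.GAN24.MonotoneTorusLandauTower
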